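import Mathlib
import Literature.NumberTheory.DiophantineGeometry.QuarticSumAndDifferenceEqCube
import HarnessLib

/-!
# Generalized Fermat equations of signature `(n, n, 3)`: `A x ^ n + B y ^ n = C z ^ 3`

Topic `Literature/NumberTheory/DiophantineGeometry` (same shelf as
`GeneralizedFermatSignatureNN2.lean`, which holds Bennett–Skinner 2004 for signature `(n, n, 2)`).

Content: the Diophantine theorems of
M. A. Bennett, V. Vatsal, S. Yazdani, *Ternary Diophantine equations of signature `(p, p, 3)`*,
Compositio Math. **140** (2004) 1399–1416, doi:10.1112/S0010437X04000983
[BennettVatsalYazdani2004] — Theorems 1.1, 1.3, 1.4, 1.5, 1.6, 1.7 (p. 1400–1401) and Theorem 8.1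
(p. 1414) — typed from the HELD primary source (Cambridge Core open PDF; journal page locators),
each as a NAMED FACT `def … : Prop` with the statement AS PRINTED, plus PROVED companions:
the printed exceptional solution of Theorem 1.5 is a genuine solution (`thm15_listed_solution`),
Theorem 1.5 packages the case `C = 1, α = 0` as "`xⁿ + yⁿ = z³` has no pairwise coprime solution
with `|xy| > 1` for prime `n ≥ 5`" (`thm15.cube`), and for Theorem 1.1 coprimality of `x` and `y`
alone already forces pairwise coprimality (`pairwise_coprime_of_sum_eq`, `thm11.of_isCoprime`),
which is the wording of the paper's abstract ("coprime integers `x` and `y`").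
Appended (same day): K. Krawciów, Colloq. Math. **123** (2011) 49–52 [Krawciow2011], Theorem 1.1
(`xⁿ + yⁿ = Mz³`, `M` cube-free with `3 ∣ M`, prime `n > M̃^{10M̃²}`) as a named fact from the
held primary, with the radical `M̃` (`Krawciow2011.rad`), the instance `M = 6` packaged
(`krawciow2011_sumOfPowersEqMCube.six`), and the `(n, C) = (3, 1)` instance of Theorem 8.1
discharged outright from Mathlib's `fermatLastTheoremThree` (`thm81_inst_three_one`).
Appended: Darmon–Merel 1997, Main Theorem part 3 (`xⁿ + yⁿ = z³`, `n ≥ 3`; the printed modularity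
hypothesis supplied by [BCDT01]) as `darmonMerel1997_sumOfPowersEqCube`, its case `n = 3` proved
from Mathlib, and the derivation of [BVY04, Thm 8.1]'s case `C = 1` from it.

Rendering conventions (uniform over the file, each recorded again in the docstrings).
(1) "no solutions in coprime integers `x, y` and `z`" is rendered with `x, y, z` PAIRWISE coprime
(`IsCoprime x y`, `IsCoprime x z`, `IsCoprime y z`). The printed word "coprime" for a triple is
read by the paper's own set-up (§2, p. 1401: "Assume `Aa`, `Bb`, and `Cc` are pairwise coprime");
should it be read as `gcd (x, y, z) = 1` instead, the facts below are WEAKER than print (fewer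
triples excluded), never stronger. (2) "`|xy| > 1`" is `1 < |x * y|`; exponents `n`, `α`, `β` are
natural numbers; primes `p`, coefficients `C` are natural numbers cast to `ℤ` in the equation.
(3) Clauses "unless, possibly, …" (the theorem asserts nothing there) are HYPOTHESES excluding those
parameters; clauses "unless `(…) = (…)`" listing actual solutions are DISJUNCTS of the conclusion.
(4) Corollary 1.2 (finiteness in `x, y, z, α, n` for `xⁿ + yⁿ = p^α z³`, via Darmon–Granville) is
not vendored.

What is deliberately NOT here: the Frey curve `E(a,b,c) : y² + 3Ccxy + C²Bbⁿy = x³`, its conductor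
(Lemma 2.1), the Serre conductor (Theorem 3.2 = Kraus, Corollary 3.3), level lowering (Lemma 3.4)
and the elimination Propositions 4.1–4.4 — modular-method inputs without Lean vocabulary here
(newforms of level `N`, mod-`n` Galois representations); they are typed as printed, with page
locators, in the venture cell's literature notes. No discharge is attempted: the proofs are the
modular method (levels `27 … 9747`, Stein's tables) plus Kraus-type arguments for Theorems
1.1/1.3/1.4.
-/

namespace Literature.NumberTheory.DiophantineGeometry

namespace BennettVatsalYazdani2004

/-- **[BVY04, Theorem 1.1]** (Compositio Math. 140 (2004), p. 1400), as printed: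
"If `p` and `n` are prime, and `α` is a nonnegative integer, then the Diophantine equation
`xⁿ + yⁿ = p^α z³` has no solutions in coprime integers `x, y` and `z` with `|xy| > 1` and
`n > p^{4p²}`." (Abstract, p. 1399: "… no solutions in coprime integers `x` and `y` with `|xy| > 1`
and prime `n > p^{4p²}`" — equivalent here, see `thm11.of_isCoprime`.) Printed remark (p. 1414):
"as the case of `p` a Mersenne prime attests, the lower bound for `n` in Theorem 1.1 cannot be
reduced to `n = o(log p)`." Rendering: pairwise coprime `x, y, z` (module docstring (1)).
[cite: BennettVatsalYazdani2004, Thm 1.1] -/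
def thm11 : Prop :=
  ∀ p n : ℕ, p.Prime → n.Prime → p ^ (4 * p ^ 2) < n → ∀ α : ℕ, ∀ x y z : ℤ,
    IsCoprime x y → IsCoprime x z → IsCoprime y z → 1 < |x * y| →
    x ^ n + y ^ n ≠ (p : ℤ) ^ α * z ^ 3

/-- The hypothesis of **[BVY04, Theorem 1.3]** on the prime `p`, as printed: "`p ≠ s³ ± 3ᵗ` for any
integers `s` and `t` with `t ≠ 1`" (for `t < 0` the number `s³ ± 3ᵗ` is not an integer, so `t`
ranges over the naturals `≠ 1` without loss). [cite: BennettVatsalYazdani2004, Thm 1.3] -/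
def Thm13Admissible (p : ℕ) : Prop :=
  ∀ s : ℤ, ∀ t : ℕ, t ≠ 1 → (p : ℤ) ≠ s ^ 3 + 3 ^ t ∧ (p : ℤ) ≠ s ^ 3 - 3 ^ t

/-- **[BVY04, Theorem 1.3]** (p. 1400), as printed: "If `p` and `n` are prime such that
`p ≠ s³ ± 3ᵗ` for any integers `s` and `t` with `t ≠ 1`, and `α` is a nonnegative integer, then the
Diophantine equation `xⁿ + p^α yⁿ = z³` has no solutions in coprime integers `x, y` and `z` with
`|xy| > 1` and `n > p^{2p}`." Rendering: pairwise coprime (module docstring (1)).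
[cite: BennettVatsalYazdani2004, Thm 1.3] -/
def thm13 : Prop :=
  ∀ p n : ℕ, p.Prime → n.Prime → Thm13Admissible p → p ^ (2 * p) < n → ∀ α : ℕ, ∀ x y z : ℤ,
    IsCoprime x y → IsCoprime x z → IsCoprime y z → 1 < |x * y| →
    x ^ n + (p : ℤ) ^ α * y ^ n ≠ z ^ 3

/-- The hypothesis of **[BVY04, Theorem 1.4]** on the prime `p`, as printed:
"`p ∉ {5, 3s³ ± 1, 9s³ ± 1 : s ∈ ℕ}`". [cite: BennettVatsalYazdani2004, Thm 1.4] -/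
def Thm14Admissible (p : ℕ) : Prop :=
  p ≠ 5 ∧ ∀ s : ℕ, p ≠ 3 * s ^ 3 + 1 ∧ p ≠ 3 * s ^ 3 - 1 ∧ p ≠ 9 * s ^ 3 + 1 ∧ p ≠ 9 * s ^ 3 - 1

/-- **[BVY04, Theorem 1.4]** (p. 1400), as printed: "If `p` and `n` are prime such that
`p ∉ {5, 3s³ ± 1, 9s³ ± 1 : s ∈ ℕ}`, and `α, β` are positive integers with `β` coprime to `3`, then
the Diophantine equation `xⁿ + p^α yⁿ = 3^β z³` has no solutions in coprime integers `x, y` and `z`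
with `|xy| > 1` and `n > p^{28p}`." Rendering: pairwise coprime (module docstring (1)).
[cite: BennettVatsalYazdani2004, Thm 1.4] -/
def thm14 : Prop :=
  ∀ p n : ℕ, p.Prime → n.Prime → Thm14Admissible p → p ^ (28 * p) < n → ∀ α β : ℕ, 0 < α → 0 < β →
    Nat.Coprime β 3 → ∀ x y z : ℤ,
    IsCoprime x y → IsCoprime x z → IsCoprime y z → 1 < |x * y| →
    x ^ n + (p : ℤ) ^ α * y ^ n ≠ 3 ^ β * z ^ 3

/-- The coefficient list of **[BVY04, Theorem 1.5]** (p. 1400):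
`C ∈ {1, 2, 3, 5, 7, 11, 13, 15, 17, 19}`. [cite: BennettVatsalYazdani2004, Thm 1.5] -/
def thm15Coefficients : Finset ℕ := {1, 2, 3, 5, 7, 11, 13, 15, 17, 19}

/-- **[BVY04, Theorem 1.5]** (p. 1400), as printed: "If `C ∈ {1, 2, 3, 5, 7, 11, 13, 15, 17, 19}`,
`n` is prime satisfying `n > max{C, 4}`, and `α` and `β` are nonnegative integers, then the
Diophantine equation `xⁿ + 3^α yⁿ = C^β z³` has no solutions in coprime integers `x, y` and `z`
with `|xy| > 1`, unless `(|x|, |y|, α, n, |C^β z³|) = (2, 1, 1, 7, 125)` or, possibly,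
`(C, n) = (7, 11)`, `(C, n) = (11, 13)` or `(α, C) = (1, p)` with `p = 2` or `p ≥ 11`."
Rendering: pairwise coprime (module docstring (1)); the three "or, possibly" clauses are
hypotheses excluding those parameters — the last one in its WEAKER reading "`α = 1` and (`C = 2` or
`C ≥ 11`)", i.e. `C ∈ {2, 11, 13, 15, 17, 19}` excluded at `α = 1`, which is how the refereed
restatement Ratcliffe–Grechuk, Expo. Math. 43 (2025), Thm 4.47 prints it ("`(α, s) ∉ {(1, t) :
t = 2, or t ≥ 11}`"); if the paper's `p` is meant to be prime (so that `(α, C) = (1, 15)` IS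
covered by the theorem), the fact below is weaker than print at that single cell, never stronger;
the genuine exception
`(|x|, |y|, α, n, |C^β z³|) = (2, 1, 1, 7, 125)` (`2⁷ + 3·(−1)⁷ = 5³`, see
`thm15_listed_solution`) is the conclusion's disjunct. Proof in print: §5 (levels
`27, 36, …, 9747`, Stein's database [Ste03], CM forms Table 1, Proposition 4.2; details in
[BVY03]). [cite: BennettVatsalYazdani2004, Thm 1.5] -/
def thm15 : Prop :=
  ∀ C ∈ thm15Coefficients, ∀ n : ℕ, n.Prime → max C 4 < n → ∀ α β : ℕ,
    ¬ (C = 7 ∧ n = 11) → ¬ (C = 11 ∧ n = 13) →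
    ¬ (α = 1 ∧ (C = 2 ∨ 11 ≤ C)) →
    ∀ x y z : ℤ, IsCoprime x y → IsCoprime x z → IsCoprime y z → 1 < |x * y| →
    x ^ n + 3 ^ α * y ^ n = (C : ℤ) ^ β * z ^ 3 →
      |x| = 2 ∧ |y| = 1 ∧ α = 1 ∧ n = 7 ∧ |(C : ℤ) ^ β * z ^ 3| = 125

/-- The prime list of **[BVY04, Theorem 1.6]** (p. 1400):
`p ∈ {5, 11, 13, 23, 29, 31, 41, 43, 47, 53, 59, 61, 67, 71, 79, 83, 97}`.
[cite: BennettVatsalYazdani2004, Thm 1.6] -/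
def thm16Primes : Finset ℕ := {5, 11, 13, 23, 29, 31, 41, 43, 47, 53, 59, 61, 67, 71, 79, 83, 97}

/-- The printed list of possibly-exceptional pairs `(p, n)` of **[BVY04, Theorem 1.6]** (p. 1400):
`{(13,19), (29,11), (43,13), (47,13), (59,11), (61,61), (67,73), (79,97), (97,13), (97,79)}`.
[cite: BennettVatsalYazdani2004, Thm 1.6] -/
def thm16Exceptional : Finset (ℕ × ℕ) :=
  {(13, 19), (29, 11), (43, 13), (47, 13), (59, 11), (61, 61), (67, 73), (79, 97), (97, 13), (97, 79)}

/-- **[BVY04, Theorem 1.6]** (p. 1400), as printed: "If `n ≥ 11` is prime,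
`p ∈ {5, 11, 13, 23, 29, 31, 41, 43, 47, 53, 59, 61, 67, 71, 79, 83, 97}` and `α` is a positive
integer, then the Diophantine equation `xⁿ + p^α yⁿ = z³` has no solutions in coprime integers
`x, y` and `z` with `|xy| > 1`, unless, possibly, `n` divides `p² − 1`, or
`(p, n) ∈ {(13,19), (29,11), (43,13), (47,13), (59,11), (61,61), (67,73), (79,97), (97,13), (97,79)}`."
Rendering: pairwise coprime (module docstring (1)); both "unless, possibly" clauses are hypotheses.
Proof in print: §5, newforms of level `3^δ p` (p. 1409), details in [BVY03].
[cite: BennettVatsalYazdani2004, Thm 1.6] -/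
def thm16 : Prop :=
  ∀ n : ℕ, n.Prime → 11 ≤ n → ∀ p ∈ thm16Primes, ∀ α : ℕ, 0 < α →
    ¬ (n ∣ p ^ 2 - 1) → (p, n) ∉ thm16Exceptional →
    ∀ x y z : ℤ, IsCoprime x y → IsCoprime x z → IsCoprime y z → 1 < |x * y| →
    x ^ n + (p : ℤ) ^ α * y ^ n ≠ z ^ 3

/-- **[BVY04, Theorem 1.7]** (pp. 1400–1401), as printed: "If `n ≥ 7` is prime, `p ∈ {7, 11, 13}`
and `α, β` are positive integers with `β` coprime to `3`, then the Diophantine equation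
`xⁿ + p^α yⁿ = 3^β z³` has no solutions in coprime integers `x, y` and `z` with `|xy| > 1`, unless,
possibly, `(p, n) = (7, 13)` or `(p, n) = (13, 7)`." Rendering: pairwise coprime (module docstring
(1)); the "unless, possibly" clause is a hypothesis. [cite: BennettVatsalYazdani2004, Thm 1.7] -/
def thm17 : Prop :=
  ∀ n : ℕ, n.Prime → 7 ≤ n → ∀ p : ℕ, p ∈ ({7, 11, 13} : Finset ℕ) → ∀ α β : ℕ, 0 < α → 0 < β →
    Nat.Coprime β 3 → ¬ (p = 7 ∧ n = 13) → ¬ (p = 13 ∧ n = 7) →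
    ∀ x y z : ℤ, IsCoprime x y → IsCoprime x z → IsCoprime y z → 1 < |x * y| →
    x ^ n + (p : ℤ) ^ α * y ^ n ≠ 3 ^ β * z ^ 3

/-- **[BVY04, Theorem 8.1]** (§8 "Concluding remarks", p. 1414), as printed: "If `C` and `n` are
integers with `1 ≤ C ≤ 5` and `n ≥ 3`, then the Diophantine equation `xⁿ + yⁿ = Cz³` has no
solutions in coprime nonzero integers `x, y` and `z` with `|xy| > 1`."
STATUS IN PRINT (recorded, not hidden): the theorem is stated after "Combining these results
[classical work on the case `n = 3`, e.g. Selmer [Sel51], and the small-exponent methods surveyed by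
Poonen [Poo98] and Bruin [Bru99]] with those of §1 enables one to derive slightly stronger versions
of our theorems; by way of example, we can show the following." — i.e. its proof is indicated, not
written out, in the paper. Rendering: integer `n ≥ 3` as a natural number, `x, y, z` nonzero and
pairwise coprime (module docstring (1)). [cite: BennettVatsalYazdani2004, Thm 8.1] -/
def thm81 : Prop :=
  ∀ n : ℕ, 3 ≤ n → ∀ C : ℤ, 1 ≤ C → C ≤ 5 → ∀ x y z : ℤ, x ≠ 0 → y ≠ 0 → z ≠ 0 →
    IsCoprime x y → IsCoprime x z → IsCoprime y z → 1 < |x * y| →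
    x ^ n + y ^ n ≠ C * z ^ 3

/-! ## Proved companions -/

/-- The exceptional tuple of [BVY04, Theorem 1.5] is a genuine solution, so the exception clause is
not vacuous: `2⁷ + 3¹·(−1)⁷ = 125 = 5³·1³ = 5⁰·5³` with `x = 2`, `y = −1` coprime, `|xy| = 2 > 1`,
`α = 1`, `n = 7`; it occurs for `(C, β, z) = (5, 3, 1)` and for every `C` with `β = 0`, `z = 5`
(and `n = 7 > max{C, 4}` restricts it to `C ∈ {1, 2, 3, 5}`).
[cite: BennettVatsalYazdani2004, Thm 1.5 (exceptional solution)] -/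
theorem thm15_listed_solution :
    (2 : ℤ) ^ 7 + 3 ^ 1 * (-1) ^ 7 = (5 : ℤ) ^ 3 * 1 ^ 3 ∧
    (2 : ℤ) ^ 7 + 3 ^ 1 * (-1) ^ 7 = (5 : ℤ) ^ 0 * 5 ^ 3 ∧
    IsCoprime (2 : ℤ) (-1) ∧ 1 < |(2 : ℤ) * (-1)| ∧ |(5 : ℤ) ^ 3 * 1 ^ 3| = 125 := by
  refine ⟨by norm_num, by norm_num, ?_, by norm_num, by norm_num⟩
  exact isCoprime_one_right.neg_right

/-- **[BVY04, Theorem 1.5], case `C = 1`, `α = 0`** packaged: for every prime `n ≥ 5` the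
equation `xⁿ + yⁿ = z³` has no solution in pairwise coprime integers with `|xy| > 1` (none of the
"possibly" clauses applies: `C = 1`, `α = 0`; the genuine exception needs `α = 1`). Proved from
the named fact. (In print this case is Darmon–Merel [DM97] for `ABC = 1`, quoted p. 1399.)
[cite: BennettVatsalYazdani2004, Thm 1.5 (C = 1)] -/
theorem thm15.cube (h : thm15) {n : ℕ} (hn : n.Prime) (h5 : 5 ≤ n) {x y z : ℤ}
    (hxy : IsCoprime x y) (hxz : IsCoprime x z) (hyz : IsCoprime y z) (hbig : 1 < |x * y|) :
    x ^ n + y ^ n ≠ z ^ 3 := by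
  intro hE
  have h1 : (1 : ℕ) ∈ thm15Coefficients := by simp [thm15Coefficients]
  have hmax : max 1 4 < n := by
    rw [max_eq_right (by norm_num : (1 : ℕ) ≤ 4)]
    omega
  have hE' : x ^ n + 3 ^ 0 * y ^ n = ((1 : ℕ) : ℤ) ^ 1 * z ^ 3 := by simpa using hE
  obtain ⟨-, -, hα, -⟩ := h 1 h1 n hn hmax 0 1 (by norm_num) (by norm_num)
    (by rintro ⟨h0, -⟩; exact absurd h0 (by norm_num)) x y z hxy hxz hyz hbig hE'
  exact absurd hα (by norm_num)

/-- Elementary bookkeeping behind the abstract's wording of [BVY04, Theorem 1.1] ("coprime integers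
`x` and `y`"): if `x` and `y` are coprime and `xⁿ + yⁿ = c·z³` with `n ≥ 1`, then `x, z` and `y, z`
are coprime as well (a common prime factor of `x` and `z` would divide `yⁿ`) — the reduction
between the abstract's and Theorem 1.1's hypotheses (p. 1399 vs p. 1400).
[cite: BennettVatsalYazdani2004, Abstract and Thm 1.1 (hypotheses)] -/
theorem pairwise_coprime_of_sum_eq {x y z c : ℤ} {n : ℕ} (hn : n ≠ 0) (hxy : IsCoprime x y)
    (hE : x ^ n + y ^ n = c * z ^ 3) : IsCoprime x z ∧ IsCoprime y z := by
  obtain ⟨m, rfl⟩ := Nat.exists_eq_succ_of_ne_zero hn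
  have key : ∀ {a b : ℤ}, IsCoprime a b → a ^ (m + 1) + b ^ (m + 1) = c * z ^ 3 →
      IsCoprime a z := by
    intro a b hab habE
    have h1 : IsCoprime a (b ^ (m + 1)) := hab.pow_right
    have h2 : IsCoprime a (c * z ^ 3) := by
      have : b ^ (m + 1) = c * z ^ 3 + a * (-a ^ m) := by
        rw [← habE, pow_succ]
        ring
      rw [this] at h1
      exact (IsCoprime.add_mul_left_right_iff).mp h1
    have h3 : IsCoprime a (z ^ 3) := h2.of_mul_right_right
    exact (IsCoprime.pow_right_iff (by norm_num : 0 < 3)).mp h3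
  refine ⟨key hxy hE, key hxy.symm ?_⟩
  rw [add_comm]; exact hE

/-- **[BVY04, Theorem 1.1] with the abstract's hypothesis** "coprime integers `x` and `y`" only
(p. 1399): equivalent to the pairwise-coprime rendering by `pairwise_coprime_of_sum_eq`.
[cite: BennettVatsalYazdani2004, Thm 1.1 and Abstract] -/
theorem thm11.of_isCoprime (h : thm11) {p n : ℕ} (hp : p.Prime) (hn : n.Prime)
    (hbound : p ^ (4 * p ^ 2) < n) (α : ℕ) {x y z : ℤ} (hxy : IsCoprime x y)
    (hbig : 1 < |x * y|) : x ^ n + y ^ n ≠ (p : ℤ) ^ α * z ^ 3 := by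
  intro hE
  obtain ⟨hxz, hyz⟩ := pairwise_coprime_of_sum_eq hn.ne_zero hxy hE
  exact h p n hp hn hbound α x y z hxy hxz hyz hbig hE

/-- Sanity examples for the admissibility predicates (kernel-checked instances of the printed
hypotheses): `7 = 2³ − 1 = 2³ − 3⁰` is NOT `Thm13Admissible` (`t = 0 ≠ 1`), and `5`, `2 = 3·1³ − 1`,
`23 = 3·2³ − 1`, `73 = 9·2³ + 1` are NOT `Thm14Admissible`; these are instances of the printed
hypotheses, not claims of the paper. [cite: BennettVatsalYazdani2004, Thms 1.3–1.4 (hypotheses; instances)] -/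
theorem admissible_examples :
    ¬ Thm13Admissible 7 ∧ ¬ Thm14Admissible 5 ∧ ¬ Thm14Admissible 2 ∧ ¬ Thm14Admissible 23 ∧
    ¬ Thm14Admissible 73 := by
  refine ⟨?_, ?_, ?_, ?_, ?_⟩
  · intro h
    exact (h 2 0 (by norm_num)).2 (by norm_num)
  · rintro ⟨h, -⟩; exact h rfl
  · rintro ⟨-, h⟩; exact (h 1).2.1 (by norm_num)
  · rintro ⟨-, h⟩; exact (h 2).2.1 (by norm_num)
  · rintro ⟨-, h⟩; exact (h 2).2.2.1 (by norm_num)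

end BennettVatsalYazdani2004

/-- **[BVY04, Theorem 8.1] at `(n, C) = (3, 1)`** — `x³ + y³ = z³` has no solution in nonzero
integers — holds outright: Euler's case of Fermat, Mathlib's `fermatLastTheoremThree`. A
kernel-checked consistency instance of the vendored rendering of Theorem 8.1 (which at `n = 3`,
`C = 1` asserts exactly this for nonzero pairwise coprime `x, y, z` with `|xy| > 1`).
[cite: BennettVatsalYazdani2004, Thm 8.1 (n = 3, C = 1; = Euler)] -/
theorem BennettVatsalYazdani2004.thm81_inst_three_one {x y z : ℤ} (hx : x ≠ 0) (hy : y ≠ 0)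
    (hz : z ≠ 0) : x ^ 3 + y ^ 3 ≠ 1 * z ^ 3 := by
  rw [one_mul]
  exact (fermatLastTheoremFor_iff_int.mp fermatLastTheoremThree) x y z hx hy hz

/-!
## Krawciów 2011: `xⁿ + yⁿ = M z³` and `xⁿ + p^α yⁿ = M z³` for cube-free `M` divisible by `3`

K. Krawciów, *On generalized Fermat equations of signature `(p,p,3)`*, Colloq. Math. **123**
(2011) 49–52, doi:10.4064/cm123-1-4 [Krawciow2011] — held (IMPAN open access, CC-BY); it
"generalizes Theorem 1.4 of [BVY04]" (abstract). Only Theorem 1.1 is vendored: Theorem 1.2 depends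
on the finite but undetermined prime sets `P(p₁, …, p_k)` ("it is not easy to determine the set
`P(p₁, …, p_k)`", p. 50) and is left in the literature notes.
-/

/-- The radical `M̃` of a natural number ("the product of all prime divisors of `M`",
[Krawciow2011, p. 49]). [cite: Krawciow2011, §1 (definition of M̃)] -/
def Krawciow2011.rad (M : ℕ) : ℕ := ∏ p ∈ M.primeFactors, p

/-- Unfolding lemma for `Krawciow2011.rad`. [cite: Krawciow2011, §1 (definition of M̃)] -/
theorem Krawciow2011.rad_def (M : ℕ) : Krawciow2011.rad M = ∏ p ∈ M.primeFactors, p := rfl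

/-- `M̃ = 6` for `M = 6`, so the printed exponent bound `M̃^{10 M̃²}` is `6³⁶⁰` there (and for
`M ∈ {12, 18, 36}`, the other cube-free `M` supported on `{2, 3}` with `3 ∣ M`).
[cite: Krawciow2011, Thm 1.1 (instance M = 6)] -/
theorem Krawciow2011.rad_six : Krawciow2011.rad 6 = 6 := by
  rw [Krawciow2011.rad, show (6 : ℕ) = 2 * 3 from rfl, Nat.primeFactors_mul (by norm_num) (by norm_num),
    Nat.prime_two.primeFactors, Nat.prime_three.primeFactors]
  decide

/-- **Krawciów 2011, Theorem 1.1** (Colloq. Math. 123 (2011), p. 50), as printed: "Let `n` be a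
prime number, and let `M` be a non-zero cube-free integer, divisible by `3`. If `n > M̃^{10M̃²}`,
then the Diophantine equation `xⁿ + yⁿ = Mz³` has no non-trivial solutions in coprime integers
`x, y` and `z`." (`M̃` = the radical of `M`; p. 49: "for all primes `n > F(M, p^α)` the equation
(1.2) has no solutions in non-zero coprime integers `x, y` and `z`".) Rendering: `M` a natural
number (a sign of `M` is absorbed by `z ↦ −z` since the exponent `3` is odd) with `M ≠ 0`,
`3 ∣ M`, cube-free as `∀ q prime, ¬ q³ ∣ M`; "non-trivial solutions in coprime integers" as
nonzero PAIRWISE coprime `x, y, z` (the weaker-or-equal reading, as for [BVY04] above; the paper's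
§2 works with "the primitive solution `(a, b, c)`" of BVY's set-up). READING NOTE recorded from the
venture cell's literature file (lit/Krawciow2011-asprinted.md): the statement carries no parity
condition on `M` as printed, and the printed proof (Lemma 2.1: every elliptic curve over `ℚ` with a
rational `3`-torsion point and conductor `3⁵ ∏ pᵢ²` has CM by `ℚ(√−3)`) does not single out
`pᵢ = 2`; for `M ∈ {6, 12, 18, 36}` (conductor `972 = 2²·3⁵`) that lemma holds by Cremona's table
(all eight curves of conductor `972` have `j = 0`). Restated without parity condition in
Ratcliffe–Grechuk, Expo. Math. 43 (2025), Thm 4.34 ("`c ≠ 0` cube-free, `3 ∣ c`, `C = rad(c)`,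
`p > C^{10C²}`"). Proof in print: BVY's Frey curve at level `3⁵ ∏ pᵢ²` (resp. `3⁵ p ∏ pᵢ²`),
[Martin 2005, Thm 2] for the non-rational forms, Lemma 2.1 + [BVY04, Prop 4.3] for the rational
ones. [cite: Krawciow2011, Thm 1.1] -/
def krawciow2011_sumOfPowersEqMCube : Prop :=
  ∀ n : ℕ, n.Prime → ∀ M : ℕ, M ≠ 0 → 3 ∣ M → (∀ q : ℕ, q.Prime → ¬ q ^ 3 ∣ M) →
    (Krawciow2011.rad M) ^ (10 * (Krawciow2011.rad M) ^ 2) < n →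
    ∀ x y z : ℤ, x ≠ 0 → y ≠ 0 → z ≠ 0 → IsCoprime x y → IsCoprime x z → IsCoprime y z →
    x ^ n + y ^ n ≠ (M : ℤ) * z ^ 3

/-- **[Krawciow2011, Thm 1.1] at `M = 6`** packaged with the bound made explicit: for every prime
`n > 6³⁶⁰` the equation `xⁿ + yⁿ = 6z³` has no solution in nonzero pairwise coprime integers
(`M̃ = 6`, `M̃^{10M̃²} = 6^{360}`). This is the printed (asymptotic) state of the art for the
coefficient `C = 6` of the family `xⁿ + yⁿ = Cz³`, which [BVY04, p. 1409] lists among the cases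
where "our techniques do not prove decisive". Proved from the named fact.
[cite: Krawciow2011, Thm 1.1 (M = 6)] -/
theorem krawciow2011_sumOfPowersEqMCube.six (h : krawciow2011_sumOfPowersEqMCube) {n : ℕ}
    (hn : n.Prime) (hbound : 6 ^ 360 < n) {x y z : ℤ} (hx : x ≠ 0) (hy : y ≠ 0) (hz : z ≠ 0)
    (hxy : IsCoprime x y) (hxz : IsCoprime x z) (hyz : IsCoprime y z) :
    x ^ n + y ^ n ≠ 6 * z ^ 3 := by
  have hrad : Krawciow2011.rad 6 = 6 := Krawciow2011.rad_six
  have hcf : ∀ q : ℕ, q.Prime → ¬ q ^ 3 ∣ 6 := by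
    intro q hq hdvd
    have hle : q ^ 3 ≤ 6 := Nat.le_of_dvd (by norm_num) hdvd
    have hq2 : 2 ≤ q := hq.two_le
    have : 2 ^ 3 ≤ q ^ 3 := Nat.pow_le_pow_left hq2 3
    omega
  have hb : Krawciow2011.rad 6 ^ (10 * Krawciow2011.rad 6 ^ 2) < n := by
    rw [hrad, show 10 * 6 ^ 2 = 360 from by norm_num]
    exact hbound
  have := h n hn 6 (by norm_num) (by norm_num) hcf hb x y z hx hy hz hxy hxz hyz
  exact_mod_cast this

/-!
## Darmon–Merel 1997, Main Theorem part 3: `xⁿ + yⁿ = z³` for `n ≥ 3` — the case `C = 1`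

H. Darmon, L. Merel, *Winding quotients and some variants of Fermat's Last Theorem*, J. reine
angew. Math. **490** (1997) 81–100 [DarmonMerel1997] — HELD primary (authors' 26-page version; page
locators refer to it). Part 1 is `darmonMerel1997_denesEquation`
(`GeneralizedFermatTwoPowerCoefficient.lean`), part 2 is `darmonMerel1997_sumOfPowersEqSquare`
(`GeneralizedFermatSignatureNN2.lean`). [BVY04] (p. 1399) cites this part as the `ABC = 1` case of
signature `(p, p, 3)`: "work of Darmon [Dar93a] and Darmon and Merel [DM97] provides a
comprehensive analysis, provided `ABC = 1`".
-/

/-- **Darmon–Merel 1997, Main Theorem, part 3** (p. 2 of the authors' version), as printed: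
"**Main Theorem** Let the exponent `n` be an arbitrary positive integer. … 3. Assume that every
elliptic curve over `ℚ` is modular. Then `xⁿ + yⁿ = z³` has no non-trivial primitive solution when
`n ≥ 3`." (definitions p. 1: primitive = `gcd(x, y, z) = 1`; trivial = "`xyz = 0` or `±1`").
STATUS OF THE PRINTED HYPOTHESIS (recorded, not hidden): the modularity assumption — needed
because "these elliptic curves have additive reduction at `3`" (p. 4) — is the theorem of
Breuil–Conrad–Diamond–Taylor [BreuilConradDiamondTaylor2001, Thm A] (every elliptic curve over `ℚ`
is modular), so the statement below is vendored WITHOUT the hypothesis, exactly as the later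
literature cites it: H. Cohen, *Number Theory II* (GTM 240, 2007), §14.6, table "Among the results
obtained to date": "`xⁿ + yⁿ = z³` | `3 ≤ n` | Darmon–Merel, Poonen" [Cohen2007NumberTheoryII];
[BVY04, p. 1399] ("a comprehensive analysis, provided `ABC = 1`", after citing [BCDT01]). (Ratcliffe–Grechuk 2025, Table 1 fn. 4, record that "[Darmon1997] does not
provide details for the case `(3,4,4)`, this case is proven in [Cohen, GTM 240, Proposition 14.6.6]".)
Proof in print: `n = 3` Euler, `n = 4` Lucas, `n = 5` Poonen [22] (p. 4: "we are also reduced to proving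
part 3 … in the case where the exponent `n` is a prime `p ≥ 7`"), prime `p ≥ 7` by the Frey curve
of §1, level-lowering and the winding quotient, modularity from [BCDT01]. Rendering: `n` a natural
number, `gcd(x, y, z) = 1` as `Int.gcd (Int.gcd x y) z = 1`, "trivial" as `xyz ∈ {0, 1, −1}`.
[cite: DarmonMerel1997, Main Theorem (3)] [cite: BreuilConradDiamondTaylor2001, Thm A (the printed
hypothesis)] [cite: Cohen2007NumberTheoryII, §14.6 table (unconditional restatement)] -/
def darmonMerel1997_sumOfPowersEqCube : Prop :=
  ∀ n : ℕ, 3 ≤ n → ∀ x y z : ℤ, Int.gcd (Int.gcd x y) z = 1 → x ^ n + y ^ n = z ^ 3 →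
    x * y * z = 0 ∨ x * y * z = 1 ∨ x * y * z = -1

/-- **The smallest case `n = 3` of [DarmonMerel1997, Main Theorem (3)] holds outright** ("This is
just Fermat's Last Theorem with exponent `3`, which was proved by Euler", p. 4): Mathlib's
`fermatLastTheoremThree`, even without the primitivity hypothesis. A kernel-checked instance of the
vendored rendering. [cite: DarmonMerel1997, Main Theorem (3), case n = 3 (Euler)] -/
theorem darmonMerel1997_sumOfPowersEqCube_three (x y z : ℤ) (hE : x ^ 3 + y ^ 3 = z ^ 3) :
    x * y * z = 0 ∨ x * y * z = 1 ∨ x * y * z = -1 := by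
  left
  by_contra hne
  have hx : x ≠ 0 := fun h => hne (by simp [h])
  have hy : y ≠ 0 := fun h => hne (by simp [h])
  have hz : z ≠ 0 := fun h => hne (by simp [h])
  exact (fermatLastTheoremFor_iff_int.mp fermatLastTheoremThree) x y z hx hy hz hE

/-- **[DarmonMerel1997, Main Theorem (3)] implies [BVY04, Theorem 8.1]'s case `C = 1`** in the
latter's normal form (nonzero pairwise coprime `x, y, z`, `|xy| > 1`, any integer `n ≥ 3`): a
pairwise coprime triple is primitive and `|xy| > 1` rules out the trivial solutions. Proved from
the named fact. [cite: BennettVatsalYazdani2004, Thm 8.1 (C = 1)] [cite: DarmonMerel1997, Main Theorem (3)] -/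
theorem BennettVatsalYazdani2004.thm81_one_of_darmonMerel (h : darmonMerel1997_sumOfPowersEqCube)
    {n : ℕ} (hn : 3 ≤ n) {x y z : ℤ} (hz : z ≠ 0) (hxy : IsCoprime x y) (hbig : 1 < |x * y|) :
    x ^ n + y ^ n ≠ 1 * z ^ 3 := by
  intro hE
  rw [one_mul] at hE
  have hg : Int.gcd (Int.gcd x y) z = 1 := by
    rw [Int.isCoprime_iff_gcd_eq_one.mp hxy]
    simp
  have habs : |x * y * z| = |x * y| * |z| := abs_mul _ _
  have hz1 : 1 ≤ |z| := Int.one_le_abs hz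
  have hgt : 1 < |x * y * z| := by
    rw [habs]
    calc (1 : ℤ) = 1 * 1 := by norm_num
      _ < |x * y| * |z| := by nlinarith [abs_nonneg (x * y), abs_nonneg z]
  rcases h n hn x y z hg hE with h0 | h0 | h0 <;> rw [h0] at hgt <;> norm_num at hgt

/-!
## Noubissie–Togbé 2020/21, Theorems 2 and 3: `2^α xⁿ + 27 yⁿ = 7 z³` and `= 13 z³`

A. Noubissie, A. Togbé, *On some ternary Diophantine equations of signature `(p, p, k)`*, Bull.
Malays. Math. Sci. Soc. **44** (2021) 163–170 (online 2020) [NoubissieTogbe2020] — HELD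
(arXiv:2504.14518 text). These are the printed sub-cases inside [BVY04, Thm 1.5]'s possibly-open
cells `(C, n) = (7, 11)` (for `x` even, `3³ ∥` the `y`-term) and beyond; Ratcliffe–Grechuk 2025,
summary table: "`2^α x^p + 27y^p = s^β z³`, `s ∈ {7, 13}`, `p > s`, `α ≥ 1`, Solved
[armandphdthesis, Noubissie21]". Printed "Remark 4. Notice that these two last theorems are also
true if we replace respectively `7` and `13` by `7^β` and `13^β`, for any positive integer `β`." —
recorded here, NOT vendored (a remark without printed proof).
-/

/-- **Noubissie–Togbé, Theorem 2** (p. 2 of the arXiv text), as printed: "Suppose that `n ≥ 11` is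
a prime number. Then the equation `2^α xⁿ + 27yⁿ = 7z³` has no solution in nonzero coprime
integers `(x, y, z)`, where `α` is a positive integer." with the §2 standing assumptions ("`Ax, By,
Cz` are coprime, `xy ≠ ±1`") rendered as hypotheses: `2^α x`, `27 y`, `7 z` pairwise coprime and
`xy ≠ ±1` (weaker-or-equal to print). [cite: NoubissieTogbe2020, Thm 2] -/
def noubissieTogbe2020_thm2 : Prop :=
  ∀ n : ℕ, n.Prime → 11 ≤ n → ∀ α : ℕ, 1 ≤ α → ∀ x y z : ℤ, x ≠ 0 → y ≠ 0 → z ≠ 0 →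
    IsCoprime (2 ^ α * x) (27 * y) → IsCoprime (2 ^ α * x) (7 * z) → IsCoprime (27 * y) (7 * z) →
    x * y ≠ 1 → x * y ≠ -1 →
    2 ^ α * x ^ n + 27 * y ^ n ≠ 7 * z ^ 3

/-- **Noubissie–Togbé, Theorem 3** (p. 2 of the arXiv text), as printed: "Suppose that `n ≥ 11`,
`n ≠ 13` is a prime number. Then the equation `2^α xⁿ + 27yⁿ = 13z³` has no solution in nonzero
coprime integers `(x, y, z)`, where `α` is a positive integer." Rendering as for Theorem 2.
[cite: NoubissieTogbe2020, Thm 3] -/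
def noubissieTogbe2020_thm3 : Prop :=
  ∀ n : ℕ, n.Prime → 11 ≤ n → n ≠ 13 → ∀ α : ℕ, 1 ≤ α → ∀ x y z : ℤ, x ≠ 0 → y ≠ 0 → z ≠ 0 →
    IsCoprime (2 ^ α * x) (27 * y) → IsCoprime (2 ^ α * x) (13 * z) → IsCoprime (27 * y) (13 * z) →
    x * y ≠ 1 → x * y ≠ -1 →
    2 ^ α * x ^ n + 27 * y ^ n ≠ 13 * z ^ 3

/-- How [NoubissieTogbe2020, Thm 2] sits inside [BVY04, Thm 1.5]'s family `xⁿ + 3^α yⁿ = C^β z³`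
(`C = 7`, `β = 1`): a pairwise coprime solution of `Xⁿ + 3^a Yⁿ = 7 Z³` with `X = 2^j x` (`x` odd,
`j ≥ 1`) and `a = 3 + n k` rewrites as `2^{nj} xⁿ + 27 (3^k Y)ⁿ = 7 Z³` — elementary bookkeeping,
kernel-checked as the identity below (no claim beyond the identity).
[cite: NoubissieTogbe2020, Thm 2 (relation to BennettVatsalYazdani2004 Thm 1.5)] -/
theorem noubissieTogbe2020_rewrite (n j k : ℕ) (x Y : ℤ) :
    (2 ^ j * x) ^ n + 3 ^ (3 + n * k) * Y ^ n = 2 ^ (n * j) * x ^ n + 27 * (3 ^ k * Y) ^ n := by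
  rw [mul_pow, mul_pow, ← pow_mul, pow_add, pow_mul]
  ring

section ExponentFourAndReduction

/-!
## The exponent `n = 4` of [DarmonMerel1997, Main Theorem (3)] and the reduction to prime exponents
(appended 2026-08-24, lit seat g10 of the venture cell `pub-abcsig`)

The imported `QuarticSumAndDifferenceEqCube.lean` PROVES [Cohen2007NumberTheoryII, Prop. 14.6.6]
(`x⁴ ± y⁴ ≠ z³` for nonzero coprime `x, y`) and with it the case `n = 4` of the named fact
(`darmonMerel1997_sumOfPowersEqCube_four`, stated there with the fact's body written out), the
exponents `3k` (Euler, Mathlib `fermatLastTheoremThree`) and `4k`, and the reduction of the fact to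
its instances at the primes `p ≥ 5`. Recorded here against the `def` itself.
-/

/-- **The named fact `darmonMerel1997_sumOfPowersEqCube` is equivalent to its restriction to prime
exponents `p ≥ 5`**: `n = 3k` is Euler's theorem and `n = 4k` is Lucas's/Cohen's `x⁴ + y⁴ ≠ z³`
(`QuarticSumAndDifferenceEqCube.lean`), and every other `n ≥ 3` is a multiple of a prime `p ≥ 5`.
[cite: DarmonMerel1997, Main Theorem (3) and p. 4] [cite: Cohen2007NumberTheoryII, Prop. 14.6.6] -/
theorem darmonMerel1997_sumOfPowersEqCube_reduction
    (hp : ∀ p : ℕ, p.Prime → 5 ≤ p → ∀ x y z : ℤ, Int.gcd (Int.gcd x y) z = 1 →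
      x ^ p + y ^ p = z ^ 3 → x * y * z = 0 ∨ x * y * z = 1 ∨ x * y * z = -1) :
    darmonMerel1997_sumOfPowersEqCube :=
  fun _ hn x y z hg hE => darmonMerel1997_sumOfPowersEqCube_of_primes hp hn x y z hg hE

end ExponentFourAndReduction

end Literature.NumberTheory.DiophantineGeometry
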